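import Summits.BirchSwinnertonDyer.BirchSwinnertonDyer.Theorems.ByReductionTypeAtTwoFineSelmerConjAAtTwoAdditivePotGoodAscentStampsA
import HarnessLib

/-!
# C4″ `AdditivePotMultOverKAtTwo` (item stmt-BirchSwinnertonDyer-22618), the (I1M′) input of the upper half on the `Δ < 0` rows:
# KERNEL STAMPS, part U — Iwasawa's `μ₂ = 0` (ZERO hypotheses) for the `2`-torsion cubic fields `d = -3547`, `d = -3720` and UNCONDITIONAL
# statement (A) at `2` for the C4″ census curves 56752e1, 89280bb1

Cell `bsd-2adic`, rung K4, seat `bsd-2adic-k4-w3` GEN 11 (explicit unit of director-bsd g16 (309)(7); `--supports stmt-BirchSwinnertonDyer-22618`).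
HONEST FRAMING (D-0036/D-0054/D-0152): THEOREMS ONLY (no definition, no named fact, no `sorry`). FIELD PART (unconditional kernel arithmetic about an
explicit cubic field `ℚ(θ)`; generator = eng-2's polredabs cubic when its index `[𝓞 : ℤ[θ]]` is odd, else an odd-index second generator):
`irreducible_cubic_<d>`, `odd_classNumber_of_root_<d>` (norm certificate below the Minkowski bound; k4-w1's `odd_classNumber_of_cubeCertificate`),
**`classicalMu_two_cubicField_<d>`** = `μ = 0` (growth form) along EVERY cyclotomic `ℤ₂`-extension of `ℚ(θ)` from `e₀ = 0` (odd `h`), `e₁ = 0` (k4-w1's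
Chevalley door at `2`, `layerOneBit_of_chevalleyCert`: a unit with `2`-adic image `≡ ±3 (mod 8)` is not a norm from `ℚ(θ, √2)`; ≤ 2 primes above `2`),
`n₀ = 0` (odd cubic discriminant `…_of_odd_cubic_discr`, or `2 = 𝔭𝔮²` with an even-index certificate `…_of_evenIndexCertificate`) and Fukuda 1994 Thm. 1 (1)
(`_holds`). These fields have TWO primes above `2` (the `2`-division cubic of a potentially multiplicative curve has a `ℚ₂`-root). ROW PART:
`conjA_two_<L>'` = Coates–Sujatha's statement (A) at `p = 2` for the census cubic model of the Cremona class (a-invariants of addL2x GEN 13's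
`nst_census-j313647.tsv`), PROVED OUTRIGHT: field identification `ℚ(β) = ℚ(θ)` + cruxlead-19573-w2's door
`TotallyComplexMu.conjA_two_cubicModel_of_classicalMu_of_discr_neg` (kernel Lim 3.5@2 + `ℓ = 2` ascent). Certificates (norm witnesses, fundamental units by a
relation sieve, Hensel data, even-index elements) found by the seat's exact-arithmetic tools (`work/tools/`) and CHECKED HERE by the kernel; eng-2's
census CERT-ADD-POTMULT-FUKUDA269-E2 agrees (`μ₂ = λ₂ = 0`, bnfcertify). Statement (A) is NOT BSD: BSD₂ for these curves is not proved; C4″ / (I1M′) stay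
research-open; nothing booked; no row of 22618 changes tier (pen RC-490 (4)). Pattern/toolkit: k4-w1 GEN 5–8 (`…MuTwoKernelRows{A,B}`, `…AscentStampsA`).

References: [CoatesSujatha2005] Conj. A, Thm. 3.4; [Iwasawa1973MuInvariants] Thm. 2/3; [Fukuda1994] Thm. 1 (1); [Lang1990] Ch. 13 §4 Lemma 4.1;
[Washington1997] §13.1; [Marcus1977] Ch. 5 Thm. 35–37; [Cohen1993] §6.3; [Lim2017FineSelmer] §3; cell files `eng2/fukuda269/{TABLE,LAYERS}-…-E2-v1.tsv`.
-/

set_option autoImplicit false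
-- sibling precedent (`…MuTwoKernelRowsA.lean`): the directory name repeats the summit name
set_option linter.dupNamespace false

noncomputable section
open scoped Classical IntermediateField NumberField Real nonZeroDivisors
namespace Summit.BirchSwinnertonDyer.BirchSwinnertonDyer.Theorems.AddKatoTwo
open WeierstrassCurve Field Polynomial IsDedekindDomain NumberField Matrix Literature.NumberTheory.EllipticCurves
  Literature.NumberTheory.GaloisRepresentations
  Literature.NumberTheory.IwasawaTheory
  Summit.BirchSwinnertonDyer.BirchSwinnertonDyer.Theorems.SteinbergFibreAtTwo
  Summit.BirchSwinnertonDyer.BirchSwinnertonDyer.Theorems.AlignedTransportAtTwoTorsionPointField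
  Summit.BirchSwinnertonDyer.BirchSwinnertonDyer.Theses.ByReductionTypeAtTwo

/-! ## The cubic field of discriminant `-3547` — odd-index generator `X³ + (-4)X² + (12)X + (-45)` (`[𝓞 : ℤ[θ]] = 3`; eng-2's polredabs cubic `X³ + (-1)X² + (-18)X + (44)` has EVEN
index `2`, unusable at `2`; `θ = (-5) + (1/2)·θ₀ + (1/2)·θ₀²`); C4″ rows 56752e1 -/

/-- `X³ + (-4)X² + (12)X + (-45)` is irreducible over `ℚ` (no root mod `7`). -/
theorem irreducible_cubic_d3547n : Irreducible (Cubic.toPoly ⟨1, ((-4 : ℤ) : ℚ), ((12 : ℤ) : ℚ), ((-45 : ℤ) : ℚ)⟩) :=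
  haveI : Fact (Nat.Prime 7) := ⟨by norm_num⟩
  irreducible_cubic_of_no_root_zmod 7 (by decide)

/-- `X³ + (-1)X² + (-18)X + (44)` (the polredabs cubic of the same field) is irreducible over `ℚ` (no root mod `7`). -/
theorem irreducible_cubic_d3547n_aux : Irreducible (Cubic.toPoly ⟨1, ((-1 : ℤ) : ℚ), ((-18 : ℤ) : ℚ), ((44 : ℤ) : ℚ)⟩) :=
  haveI : Fact (Nat.Prime 7) := ⟨by norm_num⟩
  irreducible_cubic_of_no_root_zmod 7 (by decide)

section Certd3547n

variable (K : Type) [Field K] [NumberField K]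

/-- **`h` is ODD for every cubic number field whose integers contain a root `θ` of `X³ + (-4)X² + (12)X + (-45)`** (`|disc| = 31923 = 3²·3547`,
`|d_K| ≤ 3547` by the index-`3` element `θ₀`, `M_K < 17`): a norm certificate — for every prime `ℓ < 17` and every root `a` of the cubic mod `ℓ` a generator
`(x + yθ + zθ²)/m ∈ 𝓞 K` of the ideal `I ∋ ℓ, θ − a` of norm `ℓ` (5 witnesses; 4 with `m = 3` outside `ℤ[θ]`; the prime(s) dividing the index `3` through the
second generator `θ₀` of `𝓞 K` (`exists_intElem_of_scaled_cubic`), 1 witnesses). Found by the seat's relation sieve (Hermite normal form over the `S`-unit lattice) and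
CHECKED HERE by the kernel (`pow_three_eq_span_of_cert`, `Or.inl`). eng-2's PARI value (bnfcertify): `h = 1`. KERNEL. [cite: Marcus1977, Ch. 5 Thm. 35–37 and Cor. 2] [cite: Cohen1993, §6.3] -/
theorem odd_classNumber_of_root_d3547n (h3 : Module.finrank ℚ K = 3) (b : 𝓞 K)
    (hb : b ^ 3 + (-4 : ℤ) * b ^ 2 + (12 : ℤ) * b + (-45 : ℤ) = 0) : Odd (NumberField.classNumber K) := by
  have hirr := irreducible_cubic_d3547n
  -- second generator `b2 = ((-3) + (1)θ + (-1)θ²)/3 = θ₀`, a root of `X³ + (-1)X² + (-18)X + (44)` (index `2`, prime to `3`)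
  obtain ⟨b2, hb2m, hb2⟩ := exists_intElem_of_scaled_cubic K b (-3) (1) (-1) (m := 3) (by norm_num) (-1) (-18) (44)
    (by push_cast; linear_combination (((-36 : ℤ) : 𝓞 K) + ((-7 : ℤ) : 𝓞 K) * b + ((-1 : ℤ) : 𝓞 K) * b ^ 2 + ((-1 : ℤ) : 𝓞 K) * b ^ 3 + ((0 : ℤ) : 𝓞 K) * b ^ 4) * hb)
  have hd : |NumberField.discr K| ≤ (3547 : ℕ) :=
    abs_discr_le_of_sq_mul_le K (k := 3) (by norm_num)
      (sq_mul_abs_discr_le_abs_cubic_discr K h3 b hirr hb (by norm_num) (-3) (1) (-1) ⟨b2, hb2m⟩ (by norm_num))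
      (by simp only [Cubic.discr]; norm_num)
  have hirr2 := irreducible_cubic_d3547n_aux
  refine odd_classNumber_of_cubeCertificate K h3 (B := 17)
    (minkowskiBound_lt_of_sqrt_le K h3 hd (s := 59.56)
      ((Real.sqrt_le_sqrt (by norm_num : ((3547 : ℕ) : ℝ) ≤ (59.56 : ℝ) ^ 2)).trans (Real.sqrt_sq (by norm_num)).le)
      (by norm_num)) ?_
  intro ℓ hℓB hℓ J hJ
  interval_cases ℓ <;> norm_num at hℓ
  · -- `ℓ = 2`: roots [1]
    refine pow_three_eq_span_of_cert K h3 b hirr hb (by norm_num) (fun a ha hdvd => ?_) hJ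
    interval_cases a <;> norm_num at hdvd
    · exact Or.inl ⟨(22219662734118340370433522), (-212383111967108368133443), (1920475665590981454593119), 3, by norm_num, by norm_num,
        (exists_intElem_of_scaled_cubic K b (22219662734118340370433522) (-212383111967108368133443) (1920475665590981454593119) (m := 3) (by norm_num) (-16815216809919578667340614) (-6520204915757) (-2)
          (by push_cast; linear_combination (((309678859839817391857633959659961631743820168779688690084210013439760748496 : ℤ) : 𝓞 K) + ((78991139061790403187022586553002386235709224146297847925836610834143061217 : ℤ) : 𝓞 K) * b + ((25982647892138505067647789169640977974131895692069540070687714937601271667 : ℤ) : 𝓞 K) * b ^ 2 + ((7083149784256070727039831573873615986159787646544543390176255039169104159 : ℤ) : 𝓞 K) * b ^ 3 + ((0 : ℤ) : 𝓞 K) * b ^ 4) * hb)).imp (fun _ h => h.1), by norm_num⟩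
  · -- `ℓ = 3` divides the index of `ℤ[θ]`: second generator `b2`, roots [2]
    refine pow_three_eq_span_of_cert K h3 b2 hirr2 hb2 (by norm_num) (fun a ha hdvd => ?_) hJ
    interval_cases a <;> norm_num at hdvd
    · exact Or.inl ⟨(-8774), (605), (517), 2, by norm_num, by norm_num,
        (exists_intElem_of_scaled_cubic K b2 (-8774) (605) (517) (m := 2) (by norm_num) (3294) (5962276) (3)
          (by push_cast; linear_combination (((-8580387332 : ℤ) : 𝓞 K) + ((-1596266969 : ℤ) : 𝓞 K) * b2 + ((623317948 : ℤ) : 𝓞 K) * b2 ^ 2 + ((138188413 : ℤ) : 𝓞 K) * b2 ^ 3 + ((0 : ℤ) : 𝓞 K) * b2 ^ 4) * hb2)).imp (fun _ h => h.1), by norm_num⟩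
  · -- `ℓ = 5`: roots [0]
    refine pow_three_eq_span_of_cert K h3 b hirr hb (by norm_num) (fun a ha hdvd => ?_) hJ
    interval_cases a <;> norm_num at hdvd
    · exact Or.inl ⟨(660), (1670), (-473), 3, by norm_num, by norm_num,
        (exists_intElem_of_scaled_cubic K b (660) (1670) (-473) (m := 3) (by norm_num) (-4148) (7664754) (-5)
          (by push_cast; linear_combination (((-897678405 : ℤ) : 𝓞 K) + ((-2238315464 : ℤ) : 𝓞 K) * b + ((697587022 : ℤ) : 𝓞 K) * b ^ 2 + ((-105823817 : ℤ) : 𝓞 K) * b ^ 3 + ((0 : ℤ) : 𝓞 K) * b ^ 4) * hb)).imp (fun _ h => h.1), by norm_num⟩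
  · -- `ℓ = 7`: roots []
    refine pow_three_eq_span_of_cert K h3 b hirr hb (by norm_num) (fun a ha hdvd => ?_) hJ
    interval_cases a <;> norm_num at hdvd
  · -- `ℓ = 11`: roots [6]
    refine pow_three_eq_span_of_cert K h3 b hirr hb (by norm_num) (fun a ha hdvd => ?_) hJ
    interval_cases a <;> norm_num at hdvd
    · exact Or.inl ⟨(7532), (-72), (651), 1, by norm_num, by norm_num, ⟨_, by rw [Nat.cast_one, one_mul]⟩, by norm_num⟩
  · -- `ℓ = 13`: roots [9]
    refine pow_three_eq_span_of_cert K h3 b hirr hb (by norm_num) (fun a ha hdvd => ?_) hJ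
    interval_cases a <;> norm_num at hdvd
    · exact Or.inl ⟨(-49112901), (24878102), (-3149774), 3, by norm_num, by norm_num,
        (exists_intElem_of_scaled_cubic K b (-49112901) (24878102) (-3149774) (m := 3) (by norm_num) (7542701) (787541574455679) (-13)
          (by push_cast; linear_combination (((9155320793427759946368 : ℤ) : 𝓞 K) + ((-4248823386913941989960 : ℤ) : 𝓞 K) * b + ((615456048661512385960 : ℤ) : 𝓞 K) * b ^ 2 + ((-31249148027656656824 : ℤ) : 𝓞 K) * b ^ 3 + ((0 : ℤ) : 𝓞 K) * b ^ 4) * hb)).imp (fun _ h => h.1), by norm_num⟩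

end Certd3547n

/-- **Iwasawa's `μ₂ = 0` for the cubic field of discriminant `-3547`** (`ℚ(θ)`, `θ³ + (-4)θ² + (12)θ + (-45) = 0`, index `3`; TWO primes above `2`,
`2` unramified (odd discriminant); `h` odd), KERNEL — every cyclotomic `ℤ₂`-extension of `ℚ(θ)` has `μ = 0` (growth form; indeed `e_n = 0` for all `n`).
Chevalley's door at `2` (k4-w1 `layerOneBit_of_chevalleyCert`): the fundamental unit `ε = ((290427) + (-2776)θ + (25102)θ²)/3` (regulator ≈ 12.3;
`ε³ + (-219787)ε² + (931)ε + (-1) = 0`) has `ε ≡ 3 (mod 8)` under `θ ↦ z₂ ≡ 5` (`8 ∣ g(5)`, `g'(5)` odd), so `(ε, 2)_𝔭 = −1`: a non-norm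
from `ℚ(θ, √2)`, whence `e₁ = 0`; `≤ 2` primes above `2` by `4 ∤ g(0)`, `4 ∤ g(3)`; `e₀ = 0` by `odd_classNumber_of_root_d3547n`; `n₀ = 0` because the discriminant is odd (`classicalMuVanishes_two_adjoin_of_odd_cubic_discr`); Fukuda 1994 Thm. 1 (1) (`_holds`).
The (I1M′) input of GEN 9's door for the C4″ rows 56752e1. [cite: Fukuda1994, Thm. 1 (1), p. 264] [cite: Lang1990, Ch. 13 §4, Lemma 4.1]
[cite: Washington1997, §13.1] [cite: Greenberg2001IwasawaPastPresent, §4 (Iwasawa's μ-conjecture)] -/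
theorem classicalMu_two_cubicField_d3547n {θ : AlgebraicClosure ℚ} (hθ : aeval θ (Cubic.toPoly ⟨1, ((-4 : ℤ) : ℚ), ((12 : ℤ) : ℚ), ((-45 : ℤ) : ℚ)⟩) = 0) :
    haveI : FiniteDimensional ℚ (IntermediateField.adjoin ℚ {θ}) :=
      IntermediateField.adjoin.finiteDimensional ((AlgebraicClosure.isAlgebraic ℚ).isAlgebraic θ).isIntegral
    haveI : NumberField (IntermediateField.adjoin ℚ {θ}) := NumberField.mk
    ∀ κL : ZpExtension (IntermediateField.adjoin ℚ {θ}) 2, κL.IsCyclotomic → ClassicalMuVanishes κL := by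
  intro κL hκL
  have hθ' : θ ^ 3 + (-4 : AlgebraicClosure ℚ) * θ ^ 2 + (12 : AlgebraicClosure ℚ) * θ + (-45 : AlgebraicClosure ℚ) = 0 := by
    have := hθ
    simp only [Cubic.toPoly, map_one, one_mul, aeval_add, aeval_mul, aeval_C, aeval_X_pow, aeval_X,
      eq_ratCast, Rat.cast_intCast] at this
    push_cast at this
    linear_combination this
  have he : aeval (algebraMap ℚ (AlgebraicClosure ℚ) (((290427 : ℤ) : ℚ) / ((3 : ℤ) : ℚ)) +
      algebraMap ℚ (AlgebraicClosure ℚ) (((-2776 : ℤ) : ℚ) / ((3 : ℤ) : ℚ)) * θ +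
      algebraMap ℚ (AlgebraicClosure ℚ) (((25102 : ℤ) : ℚ) / ((3 : ℤ) : ℚ)) * θ ^ 2)
      (Cubic.toPoly ⟨1, ((-219787 : ℤ) : ℚ), ((931 : ℤ) : ℚ), ((-1 : ℤ) : ℚ)⟩) = 0 := by
    simp only [Cubic.toPoly, map_one, one_mul, aeval_add, aeval_mul, aeval_C, aeval_X_pow, aeval_X, eq_ratCast,
      Rat.cast_intCast, Rat.cast_div]
    push_cast
    field_simp
    linear_combination ((691528542851544 : AlgebraicClosure ℚ) + (176391205772320 : AlgebraicClosure ℚ) * θ + (58020566000320 : AlgebraicClosure ℚ) * θ ^ 2 + (15817031361208 : AlgebraicClosure ℚ) * θ ^ 3) * hθ'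
  have hh := not_two_dvd_card_classGroup_adjoin_of_forall_cubicField_odd irreducible_cubic_d3547n (odd_classNumber_of_root_d3547n) hθ
  have h1 := layerOneBit_of_chevalleyCert irreducible_cubic_d3547n hθ hh ⟨0, by norm_num⟩ ⟨1, by norm_num⟩
      (290427) (-2776) (25102) (3) (-219787) (931) (-1) (by norm_num) he (5) (3) (by norm_num) (by norm_num) (by decide) (by decide)
  exact classicalMuVanishes_two_adjoin_of_odd_cubic_discr irreducible_cubic_d3547n (by simp only [Cubic.discr]; norm_num) hθ hh κL hκL
    (h1 κL hκL)

/-! ### Row `56752e1` (cubic field `d = -3547`) -/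

/-- The census cubic model of the C4″ row `56752e1` (`y² = x³ + (-1)x² + (-4615768)x + (-3815390736)`, addL2x GEN 13 `nst_census` a-invariants) is an elliptic curve. -/
theorem isElliptic_56752e1' : (⟨0, ((-1 : ℤ) : ℚ), 0, ((-4615768 : ℤ) : ℚ), ((-3815390736 : ℤ) : ℚ)⟩ : WeierstrassCurve ℚ).IsElliptic :=
  isElliptic_cubicModel _ _ _ (by simp only [Cubic.discr]; norm_num)

/-- **UNCONDITIONAL (A)₂ for the C4″ census curve `56752e1` — ZERO hypotheses, ZERO named facts** (additive potentially multiplicative at `2`,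
irreducible `E[2]`, `Δ < 0`; `2`-torsion cubic field `ℚ(θ)`, `θ³ + (-4)θ² + (12)θ + (-45) = 0`, `d = -31923`, `p q, f(q)=2`, `h` odd). Coates–Sujatha's
statement (A) at `p = 2` for the cubic model `y² = x³ + (-1)x² + (-4615768)x + (-3815390736)`: for every cyclotomic `ℤ₂`-extension of `ℚ` the dual fine Selmer group
over `ℚ_∞` is finitely generated over `ℤ₂` (`∃ γ D` currency). KERNEL: `classicalMu_two_cubicField_d3547n` above (μ₂(ℚ(θ)_cyc) = 0 for the field of `X³ + (-4)X² + (12)X + (-45)`) ⟹ cruxlead-19573-w2's `ℓ = 2` ascent to the totally complex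
`ℚ(E[2]) = ℚ(θ, √d)` and kernel Lim 3.5@2 (`TotallyComplexMu.conjA_two_cubicModel_of_classicalMu_of_discr_neg`); the root `β = x(T)` of the curve's cubic is
`399 + (-47/3)θ + (425/3)θ²` and `ℚ(β) = ℚ(θ)`. This discharges the (I1M′) input of this row (GEN 9 `hAnaMI_negDisc_of_cubicFieldMu`) in the kernel;
it is statement (A), NOT BSD: BSD₂ for `56752e1` is NOT proved by this. [cite: CoatesSujatha2005, Conj. A and Thm. 3.4]
[cite: Iwasawa1973MuInvariants, Thm. 2 and Thm. 3] [cite: Fukuda1994, Thm. 1 (1), p. 264] [cite: Lang1990, Ch. 13 §4, Lemma 4.1] -/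
theorem conjA_two_56752e1' (κ : ZpExtension ℚ 2) (hκ : κ.IsCyclotomic) :
    haveI := isElliptic_56752e1'
    ∃ (γ : absoluteGaloisGroup ℚ) (D : (⟨0, ((-1 : ℤ) : ℚ), 0, ((-4615768 : ℤ) : ℚ), ((-3815390736 : ℤ) : ℚ)⟩ : WeierstrassCurve ℚ).FineSelmerDualData κ γ),
      Module.Finite ℤ_[2] (RestrictScalars ℤ_[2] (IwasawaAlgebra 2) D.X) := by
  haveI := isElliptic_56752e1'
  obtain ⟨θ, hθ⟩ : ∃ θ : AlgebraicClosure ℚ, aeval θ (Cubic.toPoly ⟨1, ((-4 : ℤ) : ℚ), ((12 : ℤ) : ℚ), ((-45 : ℤ) : ℚ)⟩) = 0 :=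
    IsAlgClosed.exists_aeval_eq_zero _ _ (by rw [Cubic.degree_of_a_ne_zero one_ne_zero]; norm_num)
  have hθ' : θ ^ 3 + (-4 : AlgebraicClosure ℚ) * θ ^ 2 + (12 : AlgebraicClosure ℚ) * θ + (-45 : AlgebraicClosure ℚ) = 0 := by
    have := hθ
    simp only [Cubic.toPoly, map_one, one_mul, aeval_add, aeval_mul, aeval_C, aeval_X_pow, aeval_X,
      eq_ratCast, Rat.cast_intCast] at this
    push_cast at this
    linear_combination this
  set β : AlgebraicClosure ℚ := algebraMap ℚ (AlgebraicClosure ℚ) (399 : ℚ) +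
      algebraMap ℚ (AlgebraicClosure ℚ) (-47/3 : ℚ) * θ + algebraMap ℚ (AlgebraicClosure ℚ) (425/3 : ℚ) * θ ^ 2 with hβdef
  have hβ : aeval β (Cubic.toPoly ⟨1, ((-1 : ℤ) : ℚ), ((-4615768 : ℤ) : ℚ), ((-3815390736 : ℤ) : ℚ)⟩) = 0 := by
    simp only [Cubic.toPoly, map_one, one_mul, aeval_add, aeval_mul, aeval_C, aeval_X_pow, aeval_X, eq_ratCast,
      Rat.cast_intCast]
    rw [hβdef]
    simp only [eq_ratCast]
    push_cast
    linear_combination (((372914678 : AlgebraicClosure ℚ) / 3) + ((856088975 : AlgebraicClosure ℚ) / 27) * θ + ((281594375 : AlgebraicClosure ℚ) / 27) * θ ^ 2 + ((76765625 : AlgebraicClosure ℚ) / 27) * θ ^ 3) * hθ'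
  have hadj : IntermediateField.adjoin ℚ {β} = IntermediateField.adjoin ℚ {θ} := by
    apply le_antisymm
    · rw [IntermediateField.adjoin_simple_le_iff, hβdef]
      have hθmem := IntermediateField.mem_adjoin_simple_self ℚ θ
      exact add_mem (add_mem (algebraMap_mem _ _) (mul_mem (algebraMap_mem _ _) hθmem))
        (mul_mem (algebraMap_mem _ _) (pow_mem hθmem 2))
    · rw [IntermediateField.adjoin_simple_le_iff]
      have hθeq : θ = algebraMap ℚ (AlgebraicClosure ℚ) (326906357/32 : ℚ) +
          algebraMap ℚ (AlgebraicClosure ℚ) (527453/128 : ℚ) * β +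
          algebraMap ℚ (AlgebraicClosure ℚ) (-425/128 : ℚ) * β ^ 2 := by
        rw [hβdef]; simp only [eq_ratCast]; push_cast
        linear_combination (((145041875 : AlgebraicClosure ℚ) / 576) + ((76765625 : AlgebraicClosure ℚ) / 1152) * θ) * hθ'
      rw [hθeq]
      have hβmem := IntermediateField.mem_adjoin_simple_self ℚ β
      exact add_mem (add_mem (algebraMap_mem _ _) (mul_mem (algebraMap_mem _ _) hβmem))
        (mul_mem (algebraMap_mem _ _) (pow_mem hβmem 2))
  have h3 : Module.finrank ℚ (IntermediateField.adjoin ℚ {β}) = 3 := by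
    rw [hadj]; exact finrank_adjoin_eq_three_of_irreducible irreducible_cubic_d3547n hθ
  exact TotallyComplexMu.conjA_two_cubicModel_of_classicalMu_of_discr_neg (-1) (-4615768) (-3815390736)
    (irreducible_cubic_of_finrank_adjoin_eq_three hβ h3) (by simp only [Cubic.discr]; norm_num) hβ
    (by rw [hadj]; exact classicalMu_two_cubicField_d3547n hθ) κ hκ

/-! ## The cubic field of discriminant `-3720` — odd-index generator `X³ + (-2)X² + (11)X + (-40)` (`[𝓞 : ℤ[θ]] = 3`; eng-2's polredabs cubic `X³ + (-1)X² + (-16)X + (40)` has EVEN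
index `2`, unusable at `2`; `θ = (-5) + (1/2)·θ₀ + (1/2)·θ₀²`); C4″ rows 89280bb1 -/

/-- `X³ + (-2)X² + (11)X + (-40)` is irreducible over `ℚ` (no root mod `7`). -/
theorem irreducible_cubic_d3720n : Irreducible (Cubic.toPoly ⟨1, ((-2 : ℤ) : ℚ), ((11 : ℤ) : ℚ), ((-40 : ℤ) : ℚ)⟩) :=
  haveI : Fact (Nat.Prime 7) := ⟨by norm_num⟩
  irreducible_cubic_of_no_root_zmod 7 (by decide)

/-- `X³ + (-1)X² + (-16)X + (40)` (the polredabs cubic of the same field) is irreducible over `ℚ` (no root mod `7`). -/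
theorem irreducible_cubic_d3720n_aux : Irreducible (Cubic.toPoly ⟨1, ((-1 : ℤ) : ℚ), ((-16 : ℤ) : ℚ), ((40 : ℤ) : ℚ)⟩) :=
  haveI : Fact (Nat.Prime 7) := ⟨by norm_num⟩
  irreducible_cubic_of_no_root_zmod 7 (by decide)

section Certd3720n

variable (K : Type) [Field K] [NumberField K]

/-- **`h` is ODD for every cubic number field whose integers contain a root `θ` of `X³ + (-2)X² + (11)X + (-40)`** (`|disc| = 33480 = 3²·3720`,
`|d_K| ≤ 3720` by the index-`3` element `θ₀`, `M_K < 18`): a norm certificate — for every prime `ℓ < 18` and every root `a` of the cubic mod `ℓ` a generator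
`(x + yθ + zθ²)/m ∈ 𝓞 K` of the ideal `I ∋ ℓ, θ − a` of norm `ℓ` (8 witnesses; 0 with `m = 3` outside `ℤ[θ]`; the prime(s) dividing the index `3` through the
second generator `θ₀` of `𝓞 K` (`exists_intElem_of_scaled_cubic`), 2 witnesses). Found by the seat's relation sieve (Hermite normal form over the `S`-unit lattice) and
CHECKED HERE by the kernel (`pow_three_eq_span_of_cert`, `Or.inl`). eng-2's PARI value (bnfcertify): `h = 1`. KERNEL. [cite: Marcus1977, Ch. 5 Thm. 35–37 and Cor. 2] [cite: Cohen1993, §6.3] -/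
theorem odd_classNumber_of_root_d3720n (h3 : Module.finrank ℚ K = 3) (b : 𝓞 K)
    (hb : b ^ 3 + (-2 : ℤ) * b ^ 2 + (11 : ℤ) * b + (-40 : ℤ) = 0) : Odd (NumberField.classNumber K) := by
  have hirr := irreducible_cubic_d3720n
  -- second generator `b2 = ((-5) + (0)θ + (-1)θ²)/3 = θ₀`, a root of `X³ + (-1)X² + (-16)X + (40)` (index `2`, prime to `3`)
  obtain ⟨b2, hb2m, hb2⟩ := exists_intElem_of_scaled_cubic K b (-5) (0) (-1) (m := 3) (by norm_num) (-1) (-16) (40)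
    (by push_cast; linear_combination (((-40 : ℤ) : 𝓞 K) + ((-11 : ℤ) : 𝓞 K) * b + ((-2 : ℤ) : 𝓞 K) * b ^ 2 + ((-1 : ℤ) : 𝓞 K) * b ^ 3 + ((0 : ℤ) : 𝓞 K) * b ^ 4) * hb)
  have hd : |NumberField.discr K| ≤ (3720 : ℕ) :=
    abs_discr_le_of_sq_mul_le K (k := 3) (by norm_num)
      (sq_mul_abs_discr_le_abs_cubic_discr K h3 b hirr hb (by norm_num) (-5) (0) (-1) ⟨b2, hb2m⟩ (by norm_num))
      (by simp only [Cubic.discr]; norm_num)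
  have hirr2 := irreducible_cubic_d3720n_aux
  refine odd_classNumber_of_cubeCertificate K h3 (B := 18)
    (minkowskiBound_lt_of_sqrt_le K h3 hd (s := 61.00)
      ((Real.sqrt_le_sqrt (by norm_num : ((3720 : ℕ) : ℝ) ≤ (61.00 : ℝ) ^ 2)).trans (Real.sqrt_sq (by norm_num)).le)
      (by norm_num)) ?_
  intro ℓ hℓB hℓ J hJ
  interval_cases ℓ <;> norm_num at hℓ
  · -- `ℓ = 2`: roots [0, 1]
    refine pow_three_eq_span_of_cert K h3 b hirr hb (by norm_num) (fun a ha hdvd => ?_) hJ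
    interval_cases a <;> norm_num at hdvd
    · exact Or.inl ⟨(-178), (-12), (-13), 1, by norm_num, by norm_num, ⟨_, by rw [Nat.cast_one, one_mul]⟩, by norm_num⟩
    · exact Or.inl ⟨(3), (-1), (0), 1, by norm_num, by norm_num, ⟨_, by rw [Nat.cast_one, one_mul]⟩, by norm_num⟩
  · -- `ℓ = 3` divides the index of `ℤ[θ]`: second generator `b2`, roots [1, 2]
    refine pow_three_eq_span_of_cert K h3 b2 hirr2 hb2 (by norm_num) (fun a ha hdvd => ?_) hJ
    interval_cases a <;> norm_num at hdvd
    · exact Or.inl ⟨(-6893), (746), (504), 1, by norm_num, by norm_num, ⟨_, by rw [Nat.cast_one, one_mul]⟩, by norm_num⟩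
    · exact Or.inl ⟨(20743), (623), (-881), 1, by norm_num, by norm_num, ⟨_, by rw [Nat.cast_one, one_mul]⟩, by norm_num⟩
  · -- `ℓ = 5`: roots [0, 1]
    refine pow_three_eq_span_of_cert K h3 b hirr hb (by norm_num) (fun a ha hdvd => ?_) hJ
    interval_cases a <;> norm_num at hdvd
    · exact Or.inl ⟨(-3585), (377), (291), 1, by norm_num, by norm_num, ⟨_, by rw [Nat.cast_one, one_mul]⟩, by norm_num⟩
    · exact Or.inl ⟨(1263319), (295371), (-249125), 1, by norm_num, by norm_num, ⟨_, by rw [Nat.cast_one, one_mul]⟩, by norm_num⟩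
  · -- `ℓ = 7`: roots []
    refine pow_three_eq_span_of_cert K h3 b hirr hb (by norm_num) (fun a ha hdvd => ?_) hJ
    interval_cases a <;> norm_num at hdvd
  · -- `ℓ = 11`: roots []
    refine pow_three_eq_span_of_cert K h3 b hirr hb (by norm_num) (fun a ha hdvd => ?_) hJ
    interval_cases a <;> norm_num at hdvd
  · -- `ℓ = 13`: roots [11]
    refine pow_three_eq_span_of_cert K h3 b hirr hb (by norm_num) (fun a ha hdvd => ?_) hJ
    interval_cases a <;> norm_num at hdvd
    · exact Or.inl ⟨(-92822787126439053), (-6246758878740652), (-6779390472046794), 1, by norm_num, by norm_num, ⟨_, by rw [Nat.cast_one, one_mul]⟩, by norm_num⟩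
  · -- `ℓ = 17`: roots [6]
    refine pow_three_eq_span_of_cert K h3 b hirr hb (by norm_num) (fun a ha hdvd => ?_) hJ
    interval_cases a <;> norm_num at hdvd
    · exact Or.inl ⟨(24392386753), (1641551210), (1781518520), 1, by norm_num, by norm_num, ⟨_, by rw [Nat.cast_one, one_mul]⟩, by norm_num⟩

end Certd3720n

/-- **Iwasawa's `μ₂ = 0` for the cubic field of discriminant `-3720`** (`ℚ(θ)`, `θ³ + (-2)θ² + (11)θ + (-40) = 0`, index `3`; TWO primes above `2`,
`2 = 𝔭𝔮²`; `h` odd), KERNEL — every cyclotomic `ℤ₂`-extension of `ℚ(θ)` has `μ = 0` (growth form; indeed `e_n = 0` for all `n`).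
Chevalley's door at `2` (k4-w1 `layerOneBit_of_chevalleyCert`): the fundamental unit `ε = ((-178549653257) + (-12015978687)θ + (-13040524375)θ²)/3` (regulator ≈ 7.71;
`ε³ + (108317159465)ε² + (-636787)ε + (1) = 0`) has `ε ≡ 5 (mod 8)` under `θ ↦ z₂ ≡ 0` (`8 ∣ g(0)`, `g'(0)` odd), so `(ε, 2)_𝔭 = −1`: a non-norm
from `ℚ(θ, √2)`, whence `e₁ = 0`; `≤ 2` primes above `2` by `4 ∤ g(2)`, `4 ∤ g(1)`; `e₀ = 0` by `odd_classNumber_of_root_d3720n`; `n₀ = 0` by an even-index certificate in `ℤ[θ]` (`classicalMuVanishes_two_adjoin_of_evenIndexCertificate`); Fukuda 1994 Thm. 1 (1) (`_holds`).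
The (I1M′) input of GEN 9's door for the C4″ rows 89280bb1. [cite: Fukuda1994, Thm. 1 (1), p. 264] [cite: Lang1990, Ch. 13 §4, Lemma 4.1]
[cite: Washington1997, §13.1] [cite: Greenberg2001IwasawaPastPresent, §4 (Iwasawa's μ-conjecture)] -/
theorem classicalMu_two_cubicField_d3720n {θ : AlgebraicClosure ℚ} (hθ : aeval θ (Cubic.toPoly ⟨1, ((-2 : ℤ) : ℚ), ((11 : ℤ) : ℚ), ((-40 : ℤ) : ℚ)⟩) = 0) :
    haveI : FiniteDimensional ℚ (IntermediateField.adjoin ℚ {θ}) :=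
      IntermediateField.adjoin.finiteDimensional ((AlgebraicClosure.isAlgebraic ℚ).isAlgebraic θ).isIntegral
    haveI : NumberField (IntermediateField.adjoin ℚ {θ}) := NumberField.mk
    ∀ κL : ZpExtension (IntermediateField.adjoin ℚ {θ}) 2, κL.IsCyclotomic → ClassicalMuVanishes κL := by
  intro κL hκL
  have hθ' : θ ^ 3 + (-2 : AlgebraicClosure ℚ) * θ ^ 2 + (11 : AlgebraicClosure ℚ) * θ + (-40 : AlgebraicClosure ℚ) = 0 := by
    have := hθ
    simp only [Cubic.toPoly, map_one, one_mul, aeval_add, aeval_mul, aeval_C, aeval_X_pow, aeval_X,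
      eq_ratCast, Rat.cast_intCast] at this
    push_cast at this
    linear_combination this
  have he : aeval (algebraMap ℚ (AlgebraicClosure ℚ) (((-178549653257 : ℤ) : ℚ) / ((3 : ℤ) : ℚ)) +
      algebraMap ℚ (AlgebraicClosure ℚ) (((-12015978687 : ℤ) : ℚ) / ((3 : ℤ) : ℚ)) * θ +
      algebraMap ℚ (AlgebraicClosure ℚ) (((-13040524375 : ℤ) : ℚ) / ((3 : ℤ) : ℚ)) * θ ^ 2)
      (Cubic.toPoly ⟨1, ((108317159465 : ℤ) : ℚ), ((-636787 : ℤ) : ℚ), ((1 : ℤ) : ℚ)⟩) = 0 := by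
    simp only [Cubic.toPoly, map_one, one_mul, aeval_add, aeval_mul, aeval_C, aeval_X_pow, aeval_X, eq_ratCast,
      Rat.cast_intCast, Rat.cast_div]
    push_cast
    field_simp
    linear_combination ((-116682176596206591057017466605578 : AlgebraicClosure ℚ) + (-38215751164231675614284914748750 : AlgebraicClosure ℚ) * θ + (-10565361658079270954084348046875 : AlgebraicClosure ℚ) * θ ^ 2 + (-2217609971448936968193115234375 : AlgebraicClosure ℚ) * θ ^ 3) * hθ'
  have hh := not_two_dvd_card_classGroup_adjoin_of_forall_cubicField_odd irreducible_cubic_d3720n (odd_classNumber_of_root_d3720n) hθ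
  have h1 := layerOneBit_of_chevalleyCert irreducible_cubic_d3720n hθ hh ⟨1, by norm_num⟩ ⟨0, by norm_num⟩
      (-178549653257) (-12015978687) (-13040524375) (3) (108317159465) (-636787) (1) (by norm_num) he (0) (3) (by norm_num) (by norm_num) (by decide) (by decide)
  have hirr := irreducible_cubic_d3720n
  haveI : FiniteDimensional ℚ (IntermediateField.adjoin ℚ {θ}) :=
    IntermediateField.adjoin.finiteDimensional ((AlgebraicClosure.isAlgebraic ℚ).isAlgebraic θ).isIntegral
  haveI : NumberField (IntermediateField.adjoin ℚ {θ}) := NumberField.mk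
  obtain ⟨B, -, hB⟩ := exists_ringOfIntegers_cubic_root (p := -2) (q := 11) (r := -40) hθ
  have h3 := finrank_adjoin_eq_three_of_irreducible hirr hθ
  refine classicalMuVanishes_two_adjoin_of_evenIndexCertificate (p := -2) (q := 11) (r := -40) hirr hθ
    (((0 : ℤ) : 𝓞 (IntermediateField.adjoin ℚ {θ})) + ((-1 : ℤ) : 𝓞 (IntermediateField.adjoin ℚ {θ})) * B + ((-1 : ℤ) : 𝓞 (IntermediateField.adjoin ℚ {θ})) * B ^ 2) (((0 : ℤ) : 𝓞 (IntermediateField.adjoin ℚ {θ})) + ((-1 : ℤ) : 𝓞 (IntermediateField.adjoin ℚ {θ})) * B + ((0 : ℤ) : 𝓞 (IntermediateField.adjoin ℚ {θ})) * B ^ 2) (((40 : ℤ) : 𝓞 (IntermediateField.adjoin ℚ {θ})) + ((-1 : ℤ) : 𝓞 (IntermediateField.adjoin ℚ {θ})) * B + ((-1 : ℤ) : 𝓞 (IntermediateField.adjoin ℚ {θ})) * B ^ 2) (((880 : ℤ) : 𝓞 (IntermediateField.adjoin ℚ {θ})) + ((-42 : ℤ) : 𝓞 (IntermediateField.adjoin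 ℚ {θ})) * B + ((-41 : ℤ) : 𝓞 (IntermediateField.adjoin ℚ {θ})) * B ^ 2) ?_ ?_ ?_
    hh κL hκL (h1 κL hκL)
  · push_cast; linear_combination (((4 : ℤ) : 𝓞 (IntermediateField.adjoin ℚ {θ})) + ((1 : ℤ) : 𝓞 (IntermediateField.adjoin ℚ {θ})) * B + ((0 : ℤ) : 𝓞 (IntermediateField.adjoin ℚ {θ})) * B ^ 2) * hB
  · push_cast; linear_combination (((4 : ℤ) : 𝓞 (IntermediateField.adjoin ℚ {θ})) + ((1 : ℤ) : 𝓞 (IntermediateField.adjoin ℚ {θ})) * B + ((0 : ℤ) : 𝓞 (IntermediateField.adjoin ℚ {θ})) * B ^ 2) * hB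
  · have hz : (2 : 𝓞 (IntermediateField.adjoin ℚ {θ})) - (((880 : ℤ) : 𝓞 (IntermediateField.adjoin ℚ {θ})) + ((-42 : ℤ) : 𝓞 (IntermediateField.adjoin ℚ {θ})) * B + ((-41 : ℤ) : 𝓞 (IntermediateField.adjoin ℚ {θ})) * B ^ 2) ^ 3 =
        ((-1428142638 : ℤ) : 𝓞 (IntermediateField.adjoin ℚ {θ})) + (131720706 : ℤ) * B + (114323361 : ℤ) * B ^ 2 := by
      push_cast; linear_combination (((-18666766 : ℤ) : 𝓞 (IntermediateField.adjoin ℚ {θ})) + ((-4279703 : ℤ) : 𝓞 (IntermediateField.adjoin ℚ {θ})) * B + ((349648 : ℤ) : 𝓞 (IntermediateField.adjoin ℚ {θ})) * B ^ 2 + ((68921 : ℤ) : 𝓞 (IntermediateField.adjoin ℚ {θ})) * B ^ 3 + ((0 : ℤ) : 𝓞 (IntermediateField.adjoin ℚ {θ})) * B ^ 4) * hB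
    rw [hz]
    exact not_eight_dvd_norm_coords _ h3 B hirr hB (-1428142638) (131720706) (114323361) (N := -611354756924037463709811438)
      (by simp only [Matrix.one_fin_three, Matrix.det_fin_three, Matrix.add_apply, Matrix.smul_apply, sq, Matrix.mul_apply,
        Fin.sum_univ_three, Matrix.of_apply, Matrix.cons_val', Matrix.cons_val_zero, Matrix.cons_val_one, Matrix.cons_val_two,
        Matrix.head_cons, Matrix.tail_cons, Matrix.empty_val', Matrix.cons_val_fin_one, smul_eq_mul]; norm_num) (by norm_num)

/-! ### Row `89280bb1` (cubic field `d = -3720`) -/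

/-- The census cubic model of the C4″ row `89280bb1` (`y² = x³ + (0)x² + (-5990831148)x + (-184948647339472)`, addL2x GEN 13 `nst_census` a-invariants) is an elliptic curve. -/
theorem isElliptic_89280bb1' : (⟨0, ((0 : ℤ) : ℚ), 0, ((-5990831148 : ℤ) : ℚ), ((-184948647339472 : ℤ) : ℚ)⟩ : WeierstrassCurve ℚ).IsElliptic :=
  isElliptic_cubicModel _ _ _ (by simp only [Cubic.discr]; norm_num)

/-- **UNCONDITIONAL (A)₂ for the C4″ census curve `89280bb1` — ZERO hypotheses, ZERO named facts** (additive potentially multiplicative at `2`,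
irreducible `E[2]`, `Δ < 0`; `2`-torsion cubic field `ℚ(θ)`, `θ³ + (-2)θ² + (11)θ + (-40) = 0`, `d = -33480`, `p q^2, F_q=Q2(sqrt-2)`, `h` odd). Coates–Sujatha's
statement (A) at `p = 2` for the cubic model `y² = x³ + (0)x² + (-5990831148)x + (-184948647339472)`: for every cyclotomic `ℤ₂`-extension of `ℚ` the dual fine Selmer group
over `ℚ_∞` is finitely generated over `ℤ₂` (`∃ γ D` currency). KERNEL: `classicalMu_two_cubicField_d3720n` above (μ₂(ℚ(θ)_cyc) = 0 for the field of `X³ + (-2)X² + (11)X + (-40)`) ⟹ cruxlead-19573-w2's `ℓ = 2` ascent to the totally complex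
`ℚ(E[2]) = ℚ(θ, √d)` and kernel Lim 3.5@2 (`TotallyComplexMu.conjA_two_cubicModel_of_classicalMu_of_discr_neg`); the root `β = x(T)` of the curve's cubic is
`31732 + (3324)θ + (5658)θ²` and `ℚ(β) = ℚ(θ)`. This discharges the (I1M′) input of this row (GEN 9 `hAnaMI_negDisc_of_cubicFieldMu`) in the kernel;
it is statement (A), NOT BSD: BSD₂ for `89280bb1` is NOT proved by this. [cite: CoatesSujatha2005, Conj. A and Thm. 3.4]
[cite: Iwasawa1973MuInvariants, Thm. 2 and Thm. 3] [cite: Fukuda1994, Thm. 1 (1), p. 264] [cite: Lang1990, Ch. 13 §4, Lemma 4.1] -/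
theorem conjA_two_89280bb1' (κ : ZpExtension ℚ 2) (hκ : κ.IsCyclotomic) :
    haveI := isElliptic_89280bb1'
    ∃ (γ : absoluteGaloisGroup ℚ) (D : (⟨0, ((0 : ℤ) : ℚ), 0, ((-5990831148 : ℤ) : ℚ), ((-184948647339472 : ℤ) : ℚ)⟩ : WeierstrassCurve ℚ).FineSelmerDualData κ γ),
      Module.Finite ℤ_[2] (RestrictScalars ℤ_[2] (IwasawaAlgebra 2) D.X) := by
  haveI := isElliptic_89280bb1'
  obtain ⟨θ, hθ⟩ : ∃ θ : AlgebraicClosure ℚ, aeval θ (Cubic.toPoly ⟨1, ((-2 : ℤ) : ℚ), ((11 : ℤ) : ℚ), ((-40 : ℤ) : ℚ)⟩) = 0 :=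
    IsAlgClosed.exists_aeval_eq_zero _ _ (by rw [Cubic.degree_of_a_ne_zero one_ne_zero]; norm_num)
  have hθ' : θ ^ 3 + (-2 : AlgebraicClosure ℚ) * θ ^ 2 + (11 : AlgebraicClosure ℚ) * θ + (-40 : AlgebraicClosure ℚ) = 0 := by
    have := hθ
    simp only [Cubic.toPoly, map_one, one_mul, aeval_add, aeval_mul, aeval_C, aeval_X_pow, aeval_X,
      eq_ratCast, Rat.cast_intCast] at this
    push_cast at this
    linear_combination this
  set β : AlgebraicClosure ℚ := algebraMap ℚ (AlgebraicClosure ℚ) (31732 : ℚ) +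
      algebraMap ℚ (AlgebraicClosure ℚ) (3324 : ℚ) * θ + algebraMap ℚ (AlgebraicClosure ℚ) (5658 : ℚ) * θ ^ 2 with hβdef
  have hβ : aeval β (Cubic.toPoly ⟨1, ((0 : ℤ) : ℚ), ((-5990831148 : ℤ) : ℚ), ((-184948647339472 : ℤ) : ℚ)⟩) = 0 := by
    simp only [Cubic.toPoly, map_one, one_mul, aeval_add, aeval_mul, aeval_C, aeval_X_pow, aeval_X, eq_ratCast,
      Rat.cast_intCast]
    rw [hβdef]
    simp only [eq_ratCast]
    push_cast
    linear_combination ((8577453036816 : AlgebraicClosure ℚ) + (2605612541400 : AlgebraicClosure ℚ) * θ + (681491977632 : AlgebraicClosure ℚ) * θ ^ 2 + (181129350312 : AlgebraicClosure ℚ) * θ ^ 3) * hθ'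
  have hadj : IntermediateField.adjoin ℚ {β} = IntermediateField.adjoin ℚ {θ} := by
    apply le_antisymm
    · rw [IntermediateField.adjoin_simple_le_iff, hβdef]
      have hθmem := IntermediateField.mem_adjoin_simple_self ℚ θ
      exact add_mem (add_mem (algebraMap_mem _ _) (mul_mem (algebraMap_mem _ _) hθmem))
        (mul_mem (algebraMap_mem _ _) (pow_mem hθmem 2))
    · rw [IntermediateField.adjoin_simple_le_iff]
      have hθeq : θ = algebraMap ℚ (AlgebraicClosure ℚ) (-451649276887/28695306240 : ℚ) +
          algebraMap ℚ (AlgebraicClosure ℚ) (-18438859/114781224960 : ℚ) * β +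
          algebraMap ℚ (AlgebraicClosure ℚ) (943/229562449920 : ℚ) * β ^ 2 := by
        rw [hβdef]; simp only [eq_ratCast]; push_cast
        linear_combination (((-443735251 : AlgebraicClosure ℚ) / 1062789120) + ((-838561807 : AlgebraicClosure ℚ) / 6376734720) * θ) * hθ'
      rw [hθeq]
      have hβmem := IntermediateField.mem_adjoin_simple_self ℚ β
      exact add_mem (add_mem (algebraMap_mem _ _) (mul_mem (algebraMap_mem _ _) hβmem))
        (mul_mem (algebraMap_mem _ _) (pow_mem hβmem 2))
  have h3 : Module.finrank ℚ (IntermediateField.adjoin ℚ {β}) = 3 := by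
    rw [hadj]; exact finrank_adjoin_eq_three_of_irreducible irreducible_cubic_d3720n hθ
  exact TotallyComplexMu.conjA_two_cubicModel_of_classicalMu_of_discr_neg (0) (-5990831148) (-184948647339472)
    (irreducible_cubic_of_finrank_adjoin_eq_three hβ h3) (by simp only [Cubic.discr]; norm_num) hβ
    (by rw [hadj]; exact classicalMu_two_cubicField_d3720n hθ) κ hκ
end Summit.BirchSwinnertonDyer.BirchSwinnertonDyer.Theorems.AddKatoTwo

end
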